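import Summits.QuantumFields.BalabanUV.Beta.D1BFx.CombFPWordArrays
import Summits.QuantumFields.BalabanUV.Beta.D1BFx.PeriodicArrayWrapColH
import Summits.QuantumFields.BalabanUV.Beta.AxialDressingRootedBmHessian
import Literature.MathematicalPhysics.QuantumFieldTheory.Balaban1983to89.Beta.DecimatedMomentSummable
import Literature.MathematicalPhysics.QuantumFieldTheory.Balaban1983to89.Beta.LatticeConstantZl

/-!
# `BalabanUV.Beta.D1BFx.RestKernelFPUnit` — road «BF-x» for binder row D1, slot (K), DICT-CHAIN-SPEC §2 (II) row **RK-FP**: **«RK-FP UNIT» —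
# THE (5.10) ∕ (1.22) ROWS OF THE COMB-FP MEMBER `2 * hessKer idK1 𝒳 𝒳₂ μ ν z` OF PART 7 ∕ 8 (`PackedRoadK6cSkeleton` l.240–244), GENERIC IN THE
# FIRST-WEIGHT FAMILY AND IN THE SUP LETTER `Λ` OF THE COMB GAUGE FUNCTIONS, n-POWER EXPLICIT; AT THE ROAD's WEIGHTS `colH G₀ n` THE `hMR` ROW
# UNCONDITIONAL** (OWNER W-d1p2-g18-14: first refusal leaf-04 from 09:40Z 2026-08-22; located currency CENSUS-K6a §v4.29; `Λ` displayed on gan24-leaf-05 g53's W-2).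

HONEST DEPENDENCY (cell records, verbatim): «continuum YM on T⁴ ⇐ BetaPertH ∧ nine spine estimates (0/9 proved); BetaPertH ⇐ (D1) ∧ (D4) ∧
CAP+tail; G-an2-4 gates asym, D1 and NE2/3/4.»  HONEST FRAMING (cell contract, verbatim): «discharging `BetaPertH` makes Bałaban's UV stability
UNCONDITIONAL — a real constructive-QFT result; it is NOT the continuum limit and NOT the Clay problem.»  THIS MODULE DISCHARGES NOTHING of the
wall: [folklore] `ℓ¹` bookkeeping over OUR objects (`nFcol`, `colH`, `idK1`) BY NAME over `KCombineCovCombLeg.hessKer_idK1` (`comp idK1 V = V`: a PLAIN trace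
word), `nFcol_apply` ∕ `abs_bmF_le` ∕ `bmGaugeAt_delta1_eq_zero` (rank one, block support, sup), `biLoc_comp_biLoc` ∕ `abs_tr_le`, the (1.22) read-out
`absMoment₂_of_decay510` ∕ `secondMoment_abs_le_of_decay510`, and at the road `decays_coDressKBmAt_KInvStep` (existential letters, enough for `AbsMoment₂`).
No definition, no `def … : Prop`, no notation, nothing cited, 0 sorry.  0 root-level binders of row D1 discharged (hW ∕ hR-sockets ∕ hSX-socket ∕ D1Tel ∕ D1Rep
— 0); (K) NOT closed; NOT D1, NOT `BetaPertH`, NOT continuum, NOT Clay.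

ABSOLUTE RULE (cell charter, verbatim): «No internally-minted statement may enter as a cited fact. Every hypothesis is either kernel-proved in
this package or a verbatim quotation of a PUBLISHED theorem with page reference. The manuscript(s) under audit are NOT citable for their own
disputed steps — they are the thing under adjudication; programme-internal (2001/route/tribunal) claims are never citable.»

THE MEMBER (PART 8, `n = m + 1`, `G₀ := coDressKBmAt (toSite r) n (KInvStep n 0)`, `w := colH G₀ n`): `2 * hessKer idK1 (κ′ v ↦ Σ_κ wsum (w κ′ v κ) (nFcol r n κ))
(κ′ v l v′ ↦ Σ_κ wsum (w κ′ v κ) (u ↦ w l v′ κ u · nFcol r n κ u)) μ ν z`.  THE CURRENCY (g19 INBOX l.28887; W-14): COLLAPSE (`wsum w (nFcol κ) (x, y) =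
w (y − e_κ)·λ_{(κ, y−e_κ)}(x)`) + column envelope × mass — NOT the `biLoc_wsum` route (one spurious `Zl ≍ n⁴` per jet).  THE COUNT (letters `|w κ′ v κ u| ≤
C·e^{−δ|u − n·v|₁}`, `|λ| ≤ Λ`): tadpole `≤ 4Λ·C²·Zl 4 (δ∕2)`, bubble `≤ (4Λ·C·e^{(δ∕2)(4n+1)})²·Zl 4 (δ∕4)²`, both `× e^{−(δ∕2)·n·|z|₁}`; `Kfp_le_units` reads this at
`δ = δ₀∕n`: `≲ Λ·C²·n⁴ + Λ²·C²·n⁸` — with today's `Λ = 8n` (`abs_bmF_le`) unit class by this count IF `C = O(n⁻⁵)`, with the sharp `Λ = 2` IF `C = O(n⁻⁴)`.  SUFFICIENT,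
NOT SHARP: the count adds `|tadpole| + |bubble|`, whereas for block-smooth weights the two cancel at leading order (`λ` block-mean-free); a sharper class needs the
DIFFERENCE (located, not built).  The road's letters for `colH G₀` and `Λ` are DISPLAYED (`hG`, `hΛ`), not claimed.

CONTENT (all [folklore]). §1 COLLAPSE: `wsum_nFcol_apply`, `wsum_mul_nFcol_apply`, `fpJet_apply`, `fpTable_apply`. §2 `bmF_sup_road` (today's `Λ = 8n`),
`abs_fpTerm_le`, **`biLoc_fpJet`** (no `Zl`). §3 **`abs_tr_fpTable_le`**, **`abs_tr_comp_fpJet_le`**, **`abs_two_hessKer_idK1_fp_le`**, **`decay510_fpWord`** (rate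
`δ∕2·n`). §4 **`absMoment₂_fpWord`**, **`abs_secondMoment_fpWord_le`**, `Zl_coarse_rate_le`, **`Kfp_le_units`**. §5 AT THE ROAD: **`absMoment₂_fpWord_road`**
(UNCONDITIONAL — the FP member's `hMR` row for every `[NeZero n]` and root in the box), `decay510_fpWord_road` ∕ `abs_secondMoment_fpWord_road_le` (any rate
`0 < σ ≤ δG`, MODULO `hΛ` and `hG`).  NOT HERE (honest): a `dite`-total member with END-shape rows («FP SLOT PACK», leaf-01); the letters of `colH G₀` ∕ `Λ`; `hptw`; `TshotOf`.
Unit `b2b-balaban-beta-d1-formalise-leaf-04` (gen 20), D1 formalisation swarm leaf prover 04, road «BF-x»; INTENT 1 «RK-FP UNIT» (journal [D1LEAF04-G20-INTENT-1] + A2).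
-/

noncomputable section

open Finset
open scoped BigOperators
open Literature.MathematicalPhysics.QuantumFieldTheory.Balaban1983to89
open Literature.MathematicalPhysics.QuantumFieldTheory.Balaban1983to89.Beta
open B12Sec2to5 (l1 l1_nonneg Decay510 secondMoment_abs_le_of_decay510)
open DecimatedMomentSummable (AbsMoment₂ absMoment₂_of_decay510)
open ExpKernelCalculus (Site MKer BiLoc Decays comp tr hessKer Zl Zl_nonneg Zl_pos l1_sub_triangle l1_sub_symm l1_natSmul tsum_exp_shift'
  summable_exp_shift' biLoc_comp_biLoc abs_tr_le)
open LatticeConstantZl (Zl_le_elem)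
open AffineAveraging (box toSite unitVec)
open KKTFluctuationKernel (delta1)
open OneStepResolventKernel (wsum)
open OneStepKernelFamily (KInvStep colH abs_colH_le)
open Summit.QuantumFields.BalabanUV.Beta.AxialProjectorBlockMean (bmGaugeAt)
open Summit.QuantumFields.BalabanUV.Beta.BorderedHessian (bmGaugeAt_delta1_eq_zero)
open Summit.QuantumFields.BalabanUV.Beta.AxialDressingRooted (coDressKBmAt decays_coDressKBmAt_KInvStep)
open Summit.QuantumFields.BalabanUV.Beta.D1BFx.TorusGaugeBasisMatrix (abs_bmF_le)
open Summit.QuantumFields.BalabanUV.Beta.D1BFx.GhostStencil (l1_unitVec l1_zero)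
open Summit.QuantumFields.BalabanUV.Beta.D1BFx.GaugeJetLocal (idK1)
open Summit.QuantumFields.BalabanUV.Beta.D1BFx.KCombineCovCombLeg (hessKer_idK1)
open Summit.QuantumFields.BalabanUV.Beta.D1BFx.CombFPWordArrays (nFcol nFcol_apply l1_le_of_abs_lt)
open Summit.QuantumFields.BalabanUV.Beta.D1BFx.PeriodicArrayWrapColH (colH_weight)

namespace Summit.QuantumFields.BalabanUV.Beta.D1BFx.RestKernelFPUnit

variable (r : Fin (3 + 1) → ℕ) (n : ℕ) [NeZero n]

/-! ## §1 Collapse of the superposition against the rank-one comb-FP words -/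

omit [NeZero n] in
/-- [folklore] **COLLAPSE**: `wsum w (nFcol κ) (x, y) = w (y − e_κ)·λ_{(κ, y − e_κ)}(x)` — only the index `u = y − e_κ` survives the superposition (`tsum_eq_single`). -/
theorem wsum_nFcol_apply (w : (Fin 4 → ℤ) → ℝ) (κ : Fin 4) (x y : Fin 4 → ℤ) (a b : Unit) :
    wsum w (nFcol r n κ) x y a b = w (y - unitVec κ) * bmGaugeAt (toSite r) (delta1 κ (y - unitVec κ)) n x := by
  unfold OneStepResolventKernel.wsum
  rw [tsum_eq_single (y - unitVec κ)]
  · rw [nFcol_apply, if_pos (sub_add_cancel y (unitVec κ)).symm, mul_one]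
  · intro u hu
    rw [nFcol_apply, if_neg (fun h => hu (by rw [h, add_sub_cancel_right])), mul_zero, mul_zero]

omit [NeZero n] in
/-- [folklore] … and for the DIAGONAL TABLE weight `u ↦ w u · w′ u`: `wsum w (u ↦ w′ u · nFcol κ u) (x, y) = w (y − e_κ) · w′ (y − e_κ) · λ_{(κ, y − e_κ)}(x)`. -/
theorem wsum_mul_nFcol_apply (w w' : (Fin 4 → ℤ) → ℝ) (κ : Fin 4) (x y : Fin 4 → ℤ) (a b : Unit) :
    wsum w (fun u => fun x y a b => w' u * nFcol r n κ u x y a b) x y a b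
      = w (y - unitVec κ) * w' (y - unitVec κ) * bmGaugeAt (toSite r) (delta1 κ (y - unitVec κ)) n x := by
  unfold OneStepResolventKernel.wsum
  rw [tsum_eq_single (y - unitVec κ)]
  · beta_reduce; rw [nFcol_apply, if_pos (sub_add_cancel y (unitVec κ)).symm, mul_one, mul_assoc]
  · intro u hu
    beta_reduce; rw [nFcol_apply, if_neg (fun h => hu (by rw [h, add_sub_cancel_right])), mul_zero, mul_zero, mul_zero]

omit [NeZero n] in
/-- [folklore] THE κ-SUMMED FIRST JET IN CLOSED FORM: `Σ_κ wsum (w κ) (nFcol κ) (x, y) = Σ_κ w κ (y − e_κ) · λ_{(κ, y − e_κ)}(x)`. -/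
theorem fpJet_apply (w : Fin 4 → (Fin 4 → ℤ) → ℝ) (x y : Fin 4 → ℤ) (a b : Unit) :
    (∑ κ : Fin 4, wsum (w κ) (nFcol r n κ) x y a b)
      = ∑ κ : Fin 4, w κ (y - unitVec κ) * bmGaugeAt (toSite r) (delta1 κ (y - unitVec κ)) n x :=
  Finset.sum_congr rfl fun κ _ => wsum_nFcol_apply r n (w κ) κ x y a b

omit [NeZero n] in
/-- [folklore] THE κ-SUMMED DIAGONAL TABLE IN CLOSED FORM: `Σ_κ wsum (w κ) (u ↦ w′ κ u · nFcol κ u) (x, y) = Σ_κ w κ (y − e_κ) · w′ κ (y − e_κ) · λ_{(κ, y − e_κ)}(x)`. -/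
theorem fpTable_apply (w w' : Fin 4 → (Fin 4 → ℤ) → ℝ) (x y : Fin 4 → ℤ) (a b : Unit) :
    (∑ κ : Fin 4, wsum (w κ) (fun u => fun x y a b => w' κ u * nFcol r n κ u x y a b) x y a b)
      = ∑ κ : Fin 4, w κ (y - unitVec κ) * w' κ (y - unitVec κ) * bmGaugeAt (toSite r) (delta1 κ (y - unitVec κ)) n x :=
  Finset.sum_congr rfl fun κ _ => wsum_mul_nFcol_apply r n (w κ) (w' κ) κ x y a b

/-! ## §2 Sharp localisation of the first FP jet (no lattice constant) -/

section Generic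

variable {r n} {w w' : Fin 4 → (Fin 4 → ℤ) → ℝ} {C C' δ : ℝ} {P P' : Fin 4 → ℤ}

/-- [folklore] TODAY's SUP LETTER of the block-mean-free comb gauge functions of bond indicators: `|λ_{(κ,u)}(x)| ≤ 2·(3+1)·n` (`abs_bmF_le`, contour length).
The rows below DISPLAY the sup as a letter `Λ` (`hΛ`): a sharper sup (`Λ = 2`, gan24-leaf-05 g53 «BMF-SHARP», not in the tree at filing) re-reads every constant. -/
theorem bmF_sup_road (hr : r ∈ box (3 + 1) n) : ∀ κ u x, |bmGaugeAt (toSite r) (delta1 κ u) n x| ≤ 2 * (((3 : ℝ) + 1) * n) :=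
  fun κ u x => abs_bmF_le r n hr x u κ

variable {Λ : ℝ}

/-- [folklore] **THE TERM OF THE FIRST FP JET** (`|w u| ≤ C·e^{−δ|u−P|₁}`, `δ ≥ 0`, `|λ| ≤ Λ`): `|w (y − e_κ)·λ_{(κ, y−e_κ)}(x)| ≤ Λ·C·e^{(δ∕2)(4n+1)}·e^{−(δ∕2)(|x−P|₁+|y−P|₁)}`
— block support (`bmGaugeAt_delta1_eq_zero` ⇒ `|x − (y−e_κ)|₁ ≤ 4n`) + two triangle inequalities; the window cost `e^{(δ∕2)(4n+1)}` is n-uniform iff `δ ≲ 1∕n`. -/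
theorem abs_fpTerm_le (hr : r ∈ box (3 + 1) n) (hΛ : ∀ κ u x, |bmGaugeAt (toSite r) (delta1 κ u) n x| ≤ Λ) {w : (Fin 4 → ℤ) → ℝ}
    (hw : ∀ u, |w u| ≤ C * Real.exp (-δ * l1 (u - P))) (hδ : 0 ≤ δ) (hC : 0 ≤ C) (κ : Fin 4) (x y : Fin 4 → ℤ) :
    |w (y - unitVec κ) * bmGaugeAt (toSite r) (delta1 κ (y - unitVec κ)) n x|
      ≤ Λ * C * Real.exp (δ / 2 * (4 * n + 1)) * Real.exp (-(δ / 2) * (l1 (x - P) + l1 (y - P))) := by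
  have hΛ0 : 0 ≤ Λ := (abs_nonneg _).trans (hΛ κ (y - unitVec κ) x)
  by_cases hx : ∀ j, |x j - (y - unitVec κ) j| < (n : ℤ)
  · have hlam : |bmGaugeAt (toSite r) (delta1 κ (y - unitVec κ)) n x| ≤ Λ := hΛ κ (y - unitVec κ) x
    have hwin : l1 (x - (y - unitVec κ)) ≤ 4 * (n : ℝ) := l1_le_of_abs_lt (n := n) hx
    have hA := hw (y - unitVec κ)
    have h1 : l1 (y - P) ≤ 1 + l1 (y - unitVec κ - P) := by
      have := l1_sub_triangle y (y - unitVec κ) P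
      rwa [sub_sub_cancel, l1_unitVec] at this
    have h2 : l1 (x - P) ≤ 4 * (n : ℝ) + l1 (y - unitVec κ - P) := (l1_sub_triangle x (y - unitVec κ) P).trans (by linarith)
    have hexp : Real.exp (-δ * l1 (y - unitVec κ - P))
        ≤ Real.exp (δ / 2 * (4 * n + 1)) * Real.exp (-(δ / 2) * (l1 (x - P) + l1 (y - P))) := by
      rw [← Real.exp_add, Real.exp_le_exp]
      nlinarith [l1_nonneg (y - unitVec κ - P)]
    rw [abs_mul]
    calc |w (y - unitVec κ)| * |bmGaugeAt (toSite r) (delta1 κ (y - unitVec κ)) n x|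
        ≤ (C * Real.exp (-δ * l1 (y - unitVec κ - P))) * Λ :=
          mul_le_mul hA hlam (abs_nonneg _) ((abs_nonneg _).trans hA)
      _ ≤ (C * (Real.exp (δ / 2 * (4 * n + 1)) * Real.exp (-(δ / 2) * (l1 (x - P) + l1 (y - P))))) * Λ :=
          mul_le_mul_of_nonneg_right (mul_le_mul_of_nonneg_left hexp hC) hΛ0
      _ = _ := by ring
  · obtain ⟨j, hj⟩ := not_forall.mp hx
    rw [bmGaugeAt_delta1_eq_zero (NeZero.one_le (n := n)) hr (not_lt.mp hj), mul_zero, abs_zero]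
    positivity

/-- [folklore] **SHARP LOCALISATION OF THE FIRST FP JET** (no lattice constant): `BiLoc (Σ_κ wsum (w κ) (nFcol r n κ)) P P (4·Λ·C·e^{(δ∕2)(4n+1)}) (δ∕2)`
(the generic `biLoc_dirsum_wsum` ∘ `biLoc_nFcol_self` would read `4·C·(8n·e^{4nδ}·e^{δ})·Zl 4 (δ∕2)` — one lattice constant too many for a unit-class count). -/
theorem biLoc_fpJet (hr : r ∈ box (3 + 1) n) (hΛ : ∀ κ u x, |bmGaugeAt (toSite r) (delta1 κ u) n x| ≤ Λ)
    (hw : ∀ κ u, |w κ u| ≤ C * Real.exp (-δ * l1 (u - P))) (hδ : 0 ≤ δ) (hC : 0 ≤ C) :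
    BiLoc (fun x y a b => ∑ κ : Fin 4, wsum (w κ) (nFcol r n κ) x y a b) P P
      (4 * Λ * C * Real.exp (δ / 2 * (4 * n + 1))) (δ / 2) := by
  intro x y a b
  show |∑ κ : Fin 4, wsum (w κ) (nFcol r n κ) x y a b| ≤ _
  rw [fpJet_apply]
  calc |∑ κ : Fin 4, w κ (y - unitVec κ) * bmGaugeAt (toSite r) (delta1 κ (y - unitVec κ)) n x|
      ≤ ∑ κ : Fin 4, |w κ (y - unitVec κ) * bmGaugeAt (toSite r) (delta1 κ (y - unitVec κ)) n x| := Finset.abs_sum_le_sum_abs _ _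
    _ ≤ ∑ _κ : Fin 4, Λ * C * Real.exp (δ / 2 * (4 * n + 1)) * Real.exp (-(δ / 2) * (l1 (x - P) + l1 (y - P))) :=
        Finset.sum_le_sum fun κ _ => abs_fpTerm_le hr hΛ (hw κ) hδ hC κ x y
    _ = _ := by rw [Finset.sum_const, Finset.card_univ, Fintype.card_fin, nsmul_eq_mul]; push_cast; ring

/-! ## §3 The two trace words of the FP member -/

/-- [folklore] **THE FP TADPOLE** (ONE lattice sum; weights `w` from `P`, `w′` from `P′`, `δ > 0`, sup letter `Λ`): `|tr (Σ_κ wsum (w κ) (u ↦ w′ κ u · nFcol κ u))| ≤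
4·Λ·C·C′·Zl 4 (δ∕2)·e^{−(δ∕2)|P − P′|₁}` — diagonal term `Σ_κ w κ (x−e_κ)·w′ κ (x−e_κ)·λ(x)`, `e^{−δ|u−P|₁}·e^{−δ|u−P′|₁} ≤ e^{−(δ∕2)|P−P′|₁}·e^{−(δ∕2)|u−P|₁}`. -/
theorem abs_tr_fpTable_le (hr : r ∈ box (3 + 1) n) (hΛ : ∀ κ u x, |bmGaugeAt (toSite r) (delta1 κ u) n x| ≤ Λ)
    (hw : ∀ κ u, |w κ u| ≤ C * Real.exp (-δ * l1 (u - P)))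
    (hw' : ∀ κ u, |w' κ u| ≤ C' * Real.exp (-δ * l1 (u - P'))) (hδ : 0 < δ) (hC : 0 ≤ C) (hC' : 0 ≤ C') :
    |tr (fun x y a b => ∑ κ : Fin 4, wsum (w κ) (fun u => fun x y a b => w' κ u * nFcol r n κ u x y a b) x y a b)|
      ≤ 4 * Λ * C * C' * Zl 4 (δ / 2) * Real.exp (-(δ / 2) * l1 (P - P')) := by
  have hΛ0 : 0 ≤ Λ := (abs_nonneg _).trans (hΛ 0 0 0)
  unfold ExpKernelCalculus.tr
  simp only [Fintype.sum_unique, fpTable_apply]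
  set E : ℝ := Λ * C * C' * Real.exp (-(δ / 2) * l1 (P - P')) with hE
  have hterm : ∀ (κ : Fin 4) (x : Fin 4 → ℤ),
      |w κ (x - unitVec κ) * w' κ (x - unitVec κ) * bmGaugeAt (toSite r) (delta1 κ (x - unitVec κ)) n x|
        ≤ E * Real.exp (-(δ / 2) * l1 (x - (unitVec κ + P))) := by
    intro κ x
    by_cases hx : ∀ j, |x j - (x - unitVec κ) j| < (n : ℤ)
    · have hlam : |bmGaugeAt (toSite r) (delta1 κ (x - unitVec κ)) n x| ≤ Λ := hΛ κ (x - unitVec κ) x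
      have h1 := hw κ (x - unitVec κ); have h2 := hw' κ (x - unitVec κ)
      have htri : l1 (P - P') ≤ l1 (x - unitVec κ - P) + l1 (x - unitVec κ - P') := by
        have := l1_sub_triangle P (x - unitVec κ) P'
        rwa [l1_sub_symm P (x - unitVec κ)] at this
      have hexp : Real.exp (-δ * l1 (x - unitVec κ - P)) * Real.exp (-δ * l1 (x - unitVec κ - P'))
          ≤ Real.exp (-(δ / 2) * l1 (P - P')) * Real.exp (-(δ / 2) * l1 (x - (unitVec κ + P))) := by
        rw [← Real.exp_add, ← Real.exp_add, Real.exp_le_exp, ← sub_sub (x : Fin 4 → ℤ) (unitVec κ) P]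
        have k1 : δ * l1 (P - P') ≤ δ * (l1 (x - unitVec κ - P) + l1 (x - unitVec κ - P')) := mul_le_mul_of_nonneg_left htri hδ.le
        have k2 : 0 ≤ δ * l1 (x - unitVec κ - P') := mul_nonneg hδ.le (l1_nonneg _)
        have k3 : 0 ≤ δ * l1 (x - unitVec κ - P) := mul_nonneg hδ.le (l1_nonneg _)
        linarith
      rw [abs_mul, abs_mul]
      calc |w κ (x - unitVec κ)| * |w' κ (x - unitVec κ)| * |bmGaugeAt (toSite r) (delta1 κ (x - unitVec κ)) n x|
          ≤ (C * Real.exp (-δ * l1 (x - unitVec κ - P))) * (C' * Real.exp (-δ * l1 (x - unitVec κ - P'))) * Λ :=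
            mul_le_mul (mul_le_mul h1 h2 (abs_nonneg _) ((abs_nonneg _).trans h1)) hlam (abs_nonneg _)
              (mul_nonneg ((abs_nonneg _).trans h1) ((abs_nonneg _).trans h2))
        _ = (C * C' * Λ) * (Real.exp (-δ * l1 (x - unitVec κ - P)) * Real.exp (-δ * l1 (x - unitVec κ - P'))) := by ring
        _ ≤ (C * C' * Λ) * (Real.exp (-(δ / 2) * l1 (P - P')) * Real.exp (-(δ / 2) * l1 (x - (unitVec κ + P)))) :=
            mul_le_mul_of_nonneg_left hexp (by positivity)
        _ = E * Real.exp (-(δ / 2) * l1 (x - (unitVec κ + P))) := by rw [hE]; ring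
    · obtain ⟨j, hj⟩ := not_forall.mp hx
      rw [bmGaugeAt_delta1_eq_zero (NeZero.one_le (n := n)) hr (not_lt.mp hj), mul_zero, abs_zero]
      positivity
  have hsum : ∀ κ : Fin 4, Summable fun x : Fin 4 → ℤ => E * Real.exp (-(δ / 2) * l1 (x - (unitVec κ + P))) :=
    fun κ => (summable_exp_shift' (half_pos hδ) (unitVec κ + P)).mul_left E
  have hmaj : Summable fun x : Fin 4 → ℤ => ∑ κ : Fin 4, E * Real.exp (-(δ / 2) * l1 (x - (unitVec κ + P))) :=
    summable_sum fun κ _ => hsum κ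
  have hb := tsum_of_norm_bounded hmaj.hasSum (fun x => by
    rw [Real.norm_eq_abs]
    exact (Finset.abs_sum_le_sum_abs _ _).trans (Finset.sum_le_sum fun κ _ => hterm κ x))
  rw [Real.norm_eq_abs] at hb
  refine hb.trans (le_of_eq ?_)
  rw [Summable.tsum_finsetSum (fun κ _ => hsum κ)]
  simp only [tsum_mul_left, tsum_exp_shift']
  rw [Finset.sum_const, Finset.card_univ, Fintype.card_fin, nsmul_eq_mul, hE]
  push_cast; ring

/-- [folklore] **THE FP BUBBLE**: `|tr (𝒳[w] ∘ 𝒳[w′])| ≤ (4 Λ C e^{(δ∕2)(4n+1)})·(4 Λ C′ e^{(δ∕2)(4n+1)})·Zl 4 (δ∕4)²·e^{−(δ∕2)|P − P′|₁}` (§2 twice, `biLoc_comp_biLoc`, `abs_tr_le`). -/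
theorem abs_tr_comp_fpJet_le (hr : r ∈ box (3 + 1) n) (hΛ : ∀ κ u x, |bmGaugeAt (toSite r) (delta1 κ u) n x| ≤ Λ)
    (hw : ∀ κ u, |w κ u| ≤ C * Real.exp (-δ * l1 (u - P)))
    (hw' : ∀ κ u, |w' κ u| ≤ C' * Real.exp (-δ * l1 (u - P'))) (hδ : 0 < δ) (hC : 0 ≤ C) (hC' : 0 ≤ C') :
    |tr (comp (fun x y a b => ∑ κ : Fin 4, wsum (w κ) (nFcol r n κ) x y a b) (fun x y a b => ∑ κ : Fin 4, wsum (w' κ) (nFcol r n κ) x y a b))|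
      ≤ (4 * Λ * C * Real.exp (δ / 2 * (4 * n + 1))) * (4 * Λ * C' * Real.exp (δ / 2 * (4 * n + 1)))
          * Zl 4 (δ / 2 / 2) ^ 2 * Real.exp (-(δ / 2) * l1 (P - P')) := by
  have h4 := abs_tr_le (biLoc_comp_biLoc (biLoc_fpJet hr hΛ hw hδ.le hC) (biLoc_fpJet hr hΛ hw' hδ.le hC') (half_pos hδ)) (half_pos hδ)
  refine h4.trans (le_of_eq ?_)
  simp only [Fintype.card_unit, Nat.cast_one, one_mul]
  rw [sq, show -(δ / 2) * l1 (P - P') = -(δ / 2 / 2) * l1 (P - P') + -(δ / 2 / 2) * l1 (P - P') by ring, Real.exp_add]; ring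

/-- [folklore] Elementary: `|T| ≤ a`, `|B| ≤ b` ⟹ `|2·(½·(T − B))| ≤ a + b`. -/
theorem abs_two_mul_half_sub_le {T B a b : ℝ} (hT : |T| ≤ a) (hB : |B| ≤ b) : |2 * (1 / 2 * (T - B))| ≤ a + b := by
  rw [show (2 : ℝ) * (1 / 2 * (T - B)) = T - B by ring]; exact (abs_sub T B).trans (add_le_add hT hB)

variable {w₄ : Fin 4 → (Fin 4 → ℤ) → Fin 4 → (Fin 4 → ℤ) → ℝ}

/-- [folklore] **THE FP MEMBER, POINTWISE** (`|w κ′ v κ u| ≤ C·e^{−δ|u − n·v|₁}`, `δ > 0`, `|λ| ≤ Λ`): `|2·hessKer idK1 𝒳[w] 𝒳₂[w] μ ν z| ≤ (4·Λ·C²·Zl 4 (δ∕2) +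
(4·Λ·C·e^{(δ∕2)(4n+1)})²·Zl 4 (δ∕4)²)·e^{−(δ∕2·n)|z|₁}` (`hessKer_idK1`: `tr 𝒳₂ − tr (𝒳 ∘ 𝒳′)`; §3 at `P := n·0`, `P′ := n·z`, `|n·0 − n·z|₁ = n·|z|₁`). -/
theorem abs_two_hessKer_idK1_fp_le (hr : r ∈ box (3 + 1) n) (hΛ : ∀ κ u x, |bmGaugeAt (toSite r) (delta1 κ u) n x| ≤ Λ)
    (hw : ∀ κ' v κ u, |w₄ κ' v κ u| ≤ C * Real.exp (-δ * l1 (u - (n : ℤ) • v))) (hδ : 0 < δ) (hC : 0 ≤ C)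
    (μ ν : Fin 4) (z : Fin 4 → ℤ) : |2 * hessKer idK1 (fun κ' v => fun x y c b => ∑ κ : Fin 4, wsum (w₄ κ' v κ) (nFcol r n κ) x y c b)
        (fun κ' v l v' => fun x y c b => ∑ κ : Fin 4,
          wsum (w₄ κ' v κ) (fun u => fun x y c b => w₄ l v' κ u * nFcol r n κ u x y c b) x y c b) μ ν z|
      ≤ (4 * Λ * C * C * Zl 4 (δ / 2)
          + (4 * Λ * C * Real.exp (δ / 2 * (4 * n + 1))) * (4 * Λ * C * Real.exp (δ / 2 * (4 * n + 1))) * Zl 4 (δ / 2 / 2) ^ 2)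
        * Real.exp (-(δ / 2 * n) * l1 z) := by
  rw [hessKer_idK1]
  have hT := abs_tr_fpTable_le hr hΛ (hw μ 0) (hw ν z) hδ hC hC; have hB := abs_tr_comp_fpJet_le hr hΛ (hw μ 0) (hw ν z) hδ hC hC
  have hdist : l1 ((n : ℤ) • (0 : Fin 4 → ℤ) - (n : ℤ) • z) = (n : ℝ) * l1 z := by rw [l1_sub_symm, smul_zero, sub_zero, l1_natSmul]
  rw [hdist] at hT hB; refine (abs_two_mul_half_sub_le hT hB).trans (le_of_eq ?_)
  rw [show -(δ / 2) * ((n : ℝ) * l1 z) = -(δ / 2 * n) * l1 z by ring]; ring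

/-- [folklore] **(5.10)-SHAPE DECAY OF THE FP MEMBER IN THE COARSE VARIABLE**: constant `Kfp := 4·Λ·C²·Zl 4 (δ∕2) + (4·Λ·C·e^{(δ∕2)(4n+1)})²·Zl 4 (δ∕4)²`, rate `δ∕2·n`. -/
theorem decay510_fpWord (hr : r ∈ box (3 + 1) n) (hΛ : ∀ κ u x, |bmGaugeAt (toSite r) (delta1 κ u) n x| ≤ Λ)
    (hw : ∀ κ' v κ u, |w₄ κ' v κ u| ≤ C * Real.exp (-δ * l1 (u - (n : ℤ) • v))) (hδ : 0 < δ) (hC : 0 ≤ C) (μ ν : Fin 4) :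
    Decay510 (fun z => 2 * hessKer idK1 (fun κ' v => fun x y c b => ∑ κ : Fin 4, wsum (w₄ κ' v κ) (nFcol r n κ) x y c b)
        (fun κ' v l v' => fun x y c b => ∑ κ : Fin 4,
          wsum (w₄ κ' v κ) (fun u => fun x y c b => w₄ l v' κ u * nFcol r n κ u x y c b) x y c b) μ ν z)
      (4 * Λ * C * C * Zl 4 (δ / 2)
          + (4 * Λ * C * Real.exp (δ / 2 * (4 * n + 1))) * (4 * Λ * C * Real.exp (δ / 2 * (4 * n + 1))) * Zl 4 (δ / 2 / 2) ^ 2)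
      (δ / 2 * n) :=
  fun z => abs_two_hessKer_idK1_fp_le hr hΛ hw hδ hC μ ν z

/-! ## §4 The (1.22) read-out and the units line -/

/-- [folklore] **THE `hMR` ROW OF THE FP MEMBER** on displayed letters: absolutely summable second moments (`absMoment₂_of_decay510`). -/
theorem absMoment₂_fpWord (hr : r ∈ box (3 + 1) n) (hΛ : ∀ κ u x, |bmGaugeAt (toSite r) (delta1 κ u) n x| ≤ Λ)
    (hw : ∀ κ' v κ u, |w₄ κ' v κ u| ≤ C * Real.exp (-δ * l1 (u - (n : ℤ) • v))) (hδ : 0 < δ) (hC : 0 ≤ C) (μ ν : Fin 4) :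
    AbsMoment₂ (fun z => 2 * hessKer idK1 (fun κ' v => fun x y c b => ∑ κ : Fin 4, wsum (w₄ κ' v κ) (nFcol r n κ) x y c b)
        (fun κ' v l v' => fun x y c b => ∑ κ : Fin 4,
          wsum (w₄ κ' v κ) (fun u => fun x y c b => w₄ l v' κ u * nFcol r n κ u x y c b) x y c b) μ ν z) :=
  absMoment₂_of_decay510 (mul_pos (half_pos hδ) (Nat.cast_pos.mpr (NeZero.pos n))) (decay510_fpWord hr hΛ hw hδ hC μ ν)

/-- [folklore] **THE UNIT ROW OF THE FP MEMBER** on displayed letters: `|secondMoment (2·hessKer idK1 𝒳 𝒳₂) μ ν| ≤ Kfp · Σ'_x |x|₁²·e^{−(δ∕2·n)|x|₁}`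
(`secondMoment_abs_le_of_decay510`). -/
theorem abs_secondMoment_fpWord_le (hr : r ∈ box (3 + 1) n) (hΛ : ∀ κ u x, |bmGaugeAt (toSite r) (delta1 κ u) n x| ≤ Λ)
    (hw : ∀ κ' v κ u, |w₄ κ' v κ u| ≤ C * Real.exp (-δ * l1 (u - (n : ℤ) • v))) (hδ : 0 < δ) (hC : 0 ≤ C) (μ ν : Fin 4) :
    |B12Beta.secondMoment (fun μ ν z => 2 * hessKer idK1 (fun κ' v => fun x y c b => ∑ κ : Fin 4, wsum (w₄ κ' v κ) (nFcol r n κ) x y c b)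
        (fun κ' v l v' => fun x y c b => ∑ κ : Fin 4,
          wsum (w₄ κ' v κ) (fun u => fun x y c b => w₄ l v' κ u * nFcol r n κ u x y c b) x y c b) μ ν z) μ ν|
      ≤ (4 * Λ * C * C * Zl 4 (δ / 2)
          + (4 * Λ * C * Real.exp (δ / 2 * (4 * n + 1))) * (4 * Λ * C * Real.exp (δ / 2 * (4 * n + 1))) * Zl 4 (δ / 2 / 2) ^ 2)
        * ∑' x : Fin 4 → ℤ, l1 x ^ 2 * Real.exp (-(δ / 2 * n) * l1 x) :=
  (secondMoment_abs_le_of_decay510 (P := fun μ ν z => 2 * hessKer idK1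
      (fun κ' v => fun x y c b => ∑ κ : Fin 4, wsum (w₄ κ' v κ) (nFcol r n κ) x y c b)
      (fun κ' v l v' => fun x y c b => ∑ κ : Fin 4,
        wsum (w₄ κ' v κ) (fun u => fun x y c b => w₄ l v' κ u * nFcol r n κ u x y c b) x y c b) μ ν z)
    (mul_pos (half_pos hδ) (Nat.cast_pos.mpr (NeZero.pos n))) (decay510_fpWord hr hΛ hw hδ hC μ ν)).2

/-- [folklore] `Zl 4 (δ₀∕(c·n)) ≤ n⁴·(1 + 2c∕δ₀)⁴` for `c, δ₀ > 0`, `n ≥ 1` (`Zl_le_elem`: `Zl 4 a ≤ (1 + 2∕a)⁴`, and `1 + 2cn∕δ₀ ≤ n·(1 + 2c∕δ₀)`). -/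
theorem Zl_coarse_rate_le {δ₀ c : ℝ} (hδ₀ : 0 < δ₀) (hc : 0 < c) :
    Zl 4 (δ₀ / (c * n)) ≤ (n : ℝ) ^ 4 * (1 + 2 * c / δ₀) ^ 4 := by
  have hn : (1 : ℝ) ≤ n := Nat.one_le_cast.mpr (NeZero.one_le (n := n))
  refine (Zl_le_elem (div_pos hδ₀ (mul_pos hc (by linarith))) 4).trans ?_
  rw [← mul_pow]
  refine pow_le_pow_left₀ (by positivity) ?_ 4
  rw [div_div_eq_mul_div, mul_add, mul_one, show 2 * (c * ↑n) / δ₀ = ↑n * (2 * c / δ₀) by ring]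
  nlinarith [mul_nonneg (by linarith : (0 : ℝ) ≤ n - 1) (div_nonneg (by linarith : (0 : ℝ) ≤ 2 * c) hδ₀.le)]

/-- [folklore] **THE UNITS LINE**: at a COARSE rate `δ := δ₀∕n`, `Kfp ≤ (4·(1 + 4∕δ₀)⁴·Λ·C²)·n⁴ + (16·e^{5δ₀}·(1 + 8∕δ₀)⁸·Λ²·C²)·n⁸` — today's `Λ = 8n`: `n⁵·C²`,
`n^{10}·C²` (unit class by this absolute count IF `C = O(n⁻⁵)`); sharp `Λ = 2`: `n⁴·C²`, `n⁸·C²` (IF `C = O(n⁻⁴)`, the size «G0-COL-ENV» gives `colH G₀`).  Sufficient only. -/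
theorem Kfp_le_units {δ₀ : ℝ} (hδ₀ : 0 < δ₀) (hC : 0 ≤ C) (hΛ0 : 0 ≤ Λ) :
    4 * Λ * C * C * Zl 4 (δ₀ / n / 2)
        + (4 * Λ * C * Real.exp (δ₀ / n / 2 * (4 * n + 1))) * (4 * Λ * C * Real.exp (δ₀ / n / 2 * (4 * n + 1)))
          * Zl 4 (δ₀ / n / 2 / 2) ^ 2
      ≤ (4 * (1 + 4 / δ₀) ^ 4 * Λ * C ^ 2) * (n : ℝ) ^ 4 + (16 * Real.exp (5 * δ₀) * (1 + 8 / δ₀) ^ 8 * Λ ^ 2 * C ^ 2) * (n : ℝ) ^ 8 := by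
  have hn : (1 : ℝ) ≤ n := Nat.one_le_cast.mpr (NeZero.one_le (n := n))
  have hn0 : (0 : ℝ) < n := by linarith
  have hZ2 : Zl 4 (δ₀ / n / 2) ≤ (n : ℝ) ^ 4 * (1 + 2 * 2 / δ₀) ^ 4 := by
    rw [show δ₀ / n / 2 = δ₀ / (2 * n) by rw [div_div, mul_comm]]
    exact Zl_coarse_rate_le (n := n) hδ₀ two_pos
  have hZ4 : Zl 4 (δ₀ / n / 2 / 2) ≤ (n : ℝ) ^ 4 * (1 + 2 * 4 / δ₀) ^ 4 := by
    rw [show δ₀ / n / 2 / 2 = δ₀ / (4 * n) by rw [div_div, div_div, mul_comm, show (2 : ℝ) * 2 = 4 by norm_num, mul_comm]]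
    exact Zl_coarse_rate_le (n := n) hδ₀ (by norm_num)
  have hZ4' : (0 : ℝ) ≤ Zl 4 (δ₀ / n / 2 / 2) := Zl_nonneg (by positivity)
  have hW : Real.exp (δ₀ / n / 2 * (4 * n + 1)) * Real.exp (δ₀ / n / 2 * (4 * n + 1)) ≤ Real.exp (5 * δ₀) := by
    rw [← Real.exp_add, Real.exp_le_exp]
    have h1 : δ₀ / n / 2 * (4 * n + 1) = 2 * δ₀ + δ₀ / (2 * n) := by field_simp; ring
    have h2 : δ₀ / (2 * n) ≤ δ₀ / 2 := div_le_div_of_nonneg_left hδ₀.le two_pos (by linarith)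
    linarith
  rw [show (1 + 2 * 2 / δ₀ : ℝ) = 1 + 4 / δ₀ by norm_num] at hZ2
  rw [show (1 + 2 * 4 / δ₀ : ℝ) = 1 + 8 / δ₀ by norm_num] at hZ4
  have hA : 4 * Λ * C * C * Zl 4 (δ₀ / n / 2) ≤ (4 * (1 + 4 / δ₀) ^ 4 * Λ * C ^ 2) * (n : ℝ) ^ 4 :=
    (mul_le_mul_of_nonneg_left hZ2 (by positivity)).trans (le_of_eq (by ring))
  have hB : (4 * Λ * C * Real.exp (δ₀ / n / 2 * (4 * n + 1))) * (4 * Λ * C * Real.exp (δ₀ / n / 2 * (4 * n + 1)))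
        * Zl 4 (δ₀ / n / 2 / 2) ^ 2 ≤ (16 * Real.exp (5 * δ₀) * (1 + 8 / δ₀) ^ 8 * Λ ^ 2 * C ^ 2) * (n : ℝ) ^ 8 := by
    have hsq : Zl 4 (δ₀ / n / 2 / 2) ^ 2 ≤ ((n : ℝ) ^ 4 * (1 + 8 / δ₀) ^ 4) ^ 2 := pow_le_pow_left₀ hZ4' hZ4 2
    calc (4 * Λ * C * Real.exp (δ₀ / n / 2 * (4 * n + 1))) * (4 * Λ * C * Real.exp (δ₀ / n / 2 * (4 * n + 1)))
          * Zl 4 (δ₀ / n / 2 / 2) ^ 2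
        = (16 * Λ ^ 2 * C ^ 2) * (Real.exp (δ₀ / n / 2 * (4 * n + 1)) * Real.exp (δ₀ / n / 2 * (4 * n + 1)))
            * Zl 4 (δ₀ / n / 2 / 2) ^ 2 := by ring
      _ ≤ (16 * Λ ^ 2 * C ^ 2) * Real.exp (5 * δ₀) * ((n : ℝ) ^ 4 * (1 + 8 / δ₀) ^ 4) ^ 2 := by
          refine mul_le_mul (mul_le_mul_of_nonneg_left hW (by positivity)) hsq (by positivity) (by positivity)
      _ = _ := by ring
  exact add_le_add hA hB

end Generic

/-! ## §5 At the road's weights `colH G₀ n`, `G₀ = coDressKBmAt (toSite r) n (KInvStep n 0)` -/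

section Road

variable {r n} {Λ : ℝ}

/-- [folklore] **THE `hMR` ROW OF THE ROAD's FP MEMBER — UNCONDITIONAL**: for every block side `n ≥ 1` and every root in the box, PART 7 ∕ 8's coarse kernel
`z ↦ 2·hessKer idK1 𝒳[colH G₀ n] 𝒳₂[colH G₀ n] μ ν z` has absolutely summable second moments (existential letters `decays_coDressKBmAt_KInvStep` + `abs_colH_le`). -/
theorem absMoment₂_fpWord_road (hr : r ∈ box (3 + 1) n) (μ ν : Fin 4) :
    AbsMoment₂ (fun z => 2 * hessKer idK1
      (fun κ' v => fun x y c b => ∑ κ : Fin 4,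
        wsum (colH (coDressKBmAt (toSite r) n (KInvStep (d := 3) n 0)) n κ' v κ) (nFcol r n κ) x y c b)
      (fun κ' v l v' => fun x y c b => ∑ κ : Fin 4,
        wsum (colH (coDressKBmAt (toSite r) n (KInvStep (d := 3) n 0)) n κ' v κ)
          (fun u => fun x y c b => colH (coDressKBmAt (toSite r) n (KInvStep (d := 3) n 0)) n l v' κ u * nFcol r n κ u x y c b) x y c b)
      μ ν z) := by
  obtain ⟨δ, C, hδ, hC, hG⟩ := decays_coDressKBmAt_KInvStep (d := 3) hr 0
  exact absMoment₂_fpWord hr (bmF_sup_road hr) (fun κ' v κ u => abs_colH_le (N := n) hG κ' v κ u) hδ hC μ ν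

variable {CG δG σ : ℝ}

/-- [folklore] **THE ROAD's FP MEMBER IS A (5.10)-KERNEL AT ANY RATE `0 < σ ≤ δG`**, MODULO the displayed letters `hΛ` (today `Λ := 8n`, `bmF_sup_road`) and
`hG : Decays G₀ CG δG` (`colH_weight`): constant `4·Λ·CG²·Zl 4 (σ∕2) + (4·Λ·CG·e^{(σ∕2)(4n+1)})²·Zl 4 (σ∕4)²`, rate `σ∕2·n` (`σ ≍ 1∕n` for an n-uniform window). -/
theorem decay510_fpWord_road (hr : r ∈ box (3 + 1) n) (hΛ : ∀ κ u x, |bmGaugeAt (toSite r) (delta1 κ u) n x| ≤ Λ)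
    (hG : Decays (coDressKBmAt (toSite r) n (KInvStep (d := 3) n 0)) CG δG) (hCG : 0 ≤ CG) (hσ : 0 < σ) (hσG : σ ≤ δG) (μ ν : Fin 4) :
    Decay510 (fun z => 2 * hessKer idK1
      (fun κ' v => fun x y c b => ∑ κ : Fin 4,
        wsum (colH (coDressKBmAt (toSite r) n (KInvStep (d := 3) n 0)) n κ' v κ) (nFcol r n κ) x y c b)
      (fun κ' v l v' => fun x y c b => ∑ κ : Fin 4,
        wsum (colH (coDressKBmAt (toSite r) n (KInvStep (d := 3) n 0)) n κ' v κ)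
          (fun u => fun x y c b => colH (coDressKBmAt (toSite r) n (KInvStep (d := 3) n 0)) n l v' κ u * nFcol r n κ u x y c b) x y c b)
      μ ν z)
      (4 * Λ * CG * CG * Zl 4 (σ / 2)
          + (4 * Λ * CG * Real.exp (σ / 2 * (4 * n + 1))) * (4 * Λ * CG * Real.exp (σ / 2 * (4 * n + 1))) * Zl 4 (σ / 2 / 2) ^ 2)
      (σ / 2 * n) :=
  decay510_fpWord hr hΛ (fun κ' v κ u => colH_weight (n := n) hG hCG hσG κ' v κ u) hσ hCG μ ν

/-- [folklore] **THE UNIT ROW OF THE ROAD's FP MEMBER**, MODULO `hΛ` and `hG`: `|secondMoment (…) μ ν| ≤ Kfp(Λ, CG, σ)·Σ'_x |x|₁² e^{−(σ∕2·n)|x|₁}`. -/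
theorem abs_secondMoment_fpWord_road_le (hr : r ∈ box (3 + 1) n) (hΛ : ∀ κ u x, |bmGaugeAt (toSite r) (delta1 κ u) n x| ≤ Λ)
    (hG : Decays (coDressKBmAt (toSite r) n (KInvStep (d := 3) n 0)) CG δG) (hCG : 0 ≤ CG) (hσ : 0 < σ) (hσG : σ ≤ δG) (μ ν : Fin 4) :
    |B12Beta.secondMoment (fun μ ν z => 2 * hessKer idK1
      (fun κ' v => fun x y c b => ∑ κ : Fin 4,
        wsum (colH (coDressKBmAt (toSite r) n (KInvStep (d := 3) n 0)) n κ' v κ) (nFcol r n κ) x y c b)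
      (fun κ' v l v' => fun x y c b => ∑ κ : Fin 4,
        wsum (colH (coDressKBmAt (toSite r) n (KInvStep (d := 3) n 0)) n κ' v κ)
          (fun u => fun x y c b => colH (coDressKBmAt (toSite r) n (KInvStep (d := 3) n 0)) n l v' κ u * nFcol r n κ u x y c b) x y c b)
      μ ν z) μ ν|
      ≤ (4 * Λ * CG * CG * Zl 4 (σ / 2)
          + (4 * Λ * CG * Real.exp (σ / 2 * (4 * n + 1))) * (4 * Λ * CG * Real.exp (σ / 2 * (4 * n + 1))) * Zl 4 (σ / 2 / 2) ^ 2)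
        * ∑' x : Fin 4 → ℤ, l1 x ^ 2 * Real.exp (-(σ / 2 * n) * l1 x) :=
  abs_secondMoment_fpWord_le hr hΛ (fun κ' v κ u => colH_weight (n := n) hG hCG hσG κ' v κ u) hσ hCG μ ν

end Road

end Summit.QuantumFields.BalabanUV.Beta.D1BFx.RestKernelFPUnit

end
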